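import Literature.NumberTheory.Automorphic.ArchCartanStableSum        -- ★ `flipSet`, `flipAt ∕ negXAt ∕ angleShift ∕ cayPt` (via ★ `ArchCartanCoordinates`), `RegS ∕ InRegS`
import Mathlib.Analysis.SpecialFunctions.Complex.Circle
import HarnessLib

/-!
# THE STABLE-CLASS MAP OF THE `H_∞`-CHARTS AND LOCALISED FAMILIES: `bzClassMap S c = (tr γ_w(c), det γ_w(c), e^{i c_{w,1}})_w` and `BzLocalized Ψ b ε`
# (Bouaziz 1994 §2.3 «partition de l'unité invariante», §5.1 p. 588 «supp_G(φ)»; Rogawski 1990 §3.6, §8.2)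

Topic `NumberTheory/Rogawski1990`; namespace `Literature.NumberTheory.Rogawski1990`.  Definitions WITH BODIES and theorems (no instance, no notation, no axiom, no named fact,
no `sorry`).  Cell `pub/hodgecm-mathlib`, crux H413 (`stmt-HodgeConjecture-24833`), line LH3 (closer stub `stub_N9`), letter L3′, SURJ-OF-FORWARD road (RULINGS #22∕#23): the
vocabulary of its organs (Σ-LOC) «localisation on the stable-class space» and (Σ-LOCAL) «local surjectivity at a base class» (binder's skeleton `ArchBouazizSurjectiveAssembly`).
Author LH10-p01 (g5) (binder of record).  Count-neutral.

WHAT.  Bouaziz reduces the surjectivity of `J^st_G` to «un bon voisinage de chaque élément semi-simple» by a G-invariant partition of unity (§5.1 p. 588).  On the Cartan-indexed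
coordinate families of the tree (`Ψ : Finset W → (W → Fin 3 → ℝ) → ℂ`, ★ `ArchBouazizSpaceH`) the stable conjugacy class of a chart point `(S, c)` is recorded by the per-place
invariants of its blocks: **`bzClassMap S c w := (tr γ_w(c), det γ_w(c), e^{i c_{w,1}}) ∈ ℂ × ℂ × ℂ`** — at a split place `w ∈ S` the block `diag(e^{x+iθ}, e^{−x+iθ})` (`x = c_{w,0}`,
`θ = c_{w,2}`) gives `((eˣ + e⁻ˣ)e^{iθ}, e^{2iθ})`, at a compact place the eigenvalues `e^{i c_{w,0}}, e^{i c_{w,2}}` give `(e^{ic₀} + e^{ic₂}, e^{i(c₀+c₂)})`.  §1 proves what makes it a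
CLASS map: `2π`-periodic in every angle slot (`bzClassMap_add_angleShift`), invariant under the stable flip at a compact place (`bzClassMap_flipAt`) and under `x ↦ −x` at a split place
(`bzClassMap_negXAt`), hence under every `flipSet` (`bzClassMap_flipSet`), continuous (`continuous_bzClassMap`), and — the two-chart seam — **`bzClassMap_insert_cayPt`**: at a wall point
`s` (`s_{w,0} = s_{w,2}`) the compact chart `S` and the split chart `insert w S` at the Cayley point `cayPt w s` have THE SAME class data.  §2: **`BzLocalized Ψ b ε`** («`Ψ` vanishes at
every chart point whose class is `ε`-far from `b`») and its closure properties (zero, mono, add, smul, neg, finite sums) — localised members of `ArchBouazizSpaceH jcH` form a submodule,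
which is what the gluing `JG(φ₁ + ⋯ + φₙ) = ψ` uses.
HONEST LABEL: HC_CM is proved only modulo the 7 printed citations (2 remaining: hLiu418 = stmt-HodgeConjecture-24832, h413 = stmt-HodgeConjecture-24833) until rung 0 closes;
vocabulary, pays nothing by itself.

## References
* [Bouaziz1994IntegralesOrbitales] A. Bouaziz, *Intégrales orbitales sur les groupes de Lie réductifs*, Ann. Sci. ÉNS (4) 27 (1994) 573–609, §2.3 Lemme 2.3.1, §5.1 p. 588.
* [Rogawski1990] J. D. Rogawski, *Automorphic Representations of Unitary Groups in Three Variables*, Ann. of Math. Stud. 123 (1990), §3.6 p. 31; §8.2 p. 122.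
* [Shelstad1979] D. Shelstad, *Characters and inner forms of a quasi-split group over ℝ*, Compositio Math. 39 (1979), §4 pp. 22–25.
-/

set_option autoImplicit false

noncomputable section

open Complex Set Function Real
open Literature.NumberTheory.Automorphic.ArchCartan

namespace Literature.NumberTheory.Rogawski1990

variable {W : Type*}

/-! ## §1 The class map -/

section ClassMap

variable [DecidableEq W]

/-- **The per-place CLASS MAP of a chart point** `(S, c) ↦ (tr γ_w(c), det γ_w(c), e^{i c_{w,1}})_w`: at a split place `w ∈ S` the `2`-block `diag(e^{x+iθ}, e^{−x+iθ})`
(`x = c_{w,0}`, `θ = c_{w,2}`) has trace `(eˣ + e⁻ˣ) e^{iθ}` and determinant `e^{2iθ}`; at a compact place the Cayley block with eigenvalues `e^{i c_{w,0}}, e^{i c_{w,2}}` has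
trace `e^{i c_{w,0}} + e^{i c_{w,2}}` and determinant `e^{i(c_{w,0} + c_{w,2})}`; the `U(Φ₁)`-entry is `e^{i c_{w,1}}`.  Two chart points represent stably conjugate elements of
`H_∞` iff their class data agree (the eigenvalue multiset of each block and the `U(1)`-part). [cite: Bouaziz1994IntegralesOrbitales, §2.3 p. 578; §5.1 p. 588]
[cite: Rogawski1990, §3.6 p. 31; §8.2 p. 122] -/
def bzClassMap (S : Finset W) (c : W → Fin 3 → ℝ) (w : W) : ℂ × ℂ × ℂ :=
  if w ∈ S then ((((Real.exp (c w 0) + Real.exp (-(c w 0)) : ℝ) : ℂ)) * (Circle.exp (c w 2) : ℂ), (Circle.exp (c w 2) : ℂ) ^ 2, (Circle.exp (c w 1) : ℂ))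
  else (((Circle.exp (c w 0) : ℂ)) + (Circle.exp (c w 2) : ℂ), ((Circle.exp (c w 0) : ℂ)) * (Circle.exp (c w 2) : ℂ), (Circle.exp (c w 1) : ℂ))

/-- The class data at a split place. [cite: Rogawski1990, §3.6 p. 31] -/
theorem bzClassMap_of_mem {S : Finset W} {w : W} (hw : w ∈ S) (c : W → Fin 3 → ℝ) :
    bzClassMap S c w = ((((Real.exp (c w 0) + Real.exp (-(c w 0)) : ℝ) : ℂ)) * (Circle.exp (c w 2) : ℂ), (Circle.exp (c w 2) : ℂ) ^ 2, (Circle.exp (c w 1) : ℂ)) := by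
  rw [bzClassMap, if_pos hw]

/-- The class data at a compact place. [cite: Rogawski1990, §8.2 p. 122] -/
theorem bzClassMap_of_not_mem {S : Finset W} {w : W} (hw : w ∉ S) (c : W → Fin 3 → ℝ) :
    bzClassMap S c w = (((Circle.exp (c w 0) : ℂ)) + (Circle.exp (c w 2) : ℂ), ((Circle.exp (c w 0) : ℂ)) * (Circle.exp (c w 2) : ℂ), (Circle.exp (c w 1) : ℂ)) := by
  rw [bzClassMap, if_neg hw]

/-- The class map reads the place `w` only through `c w`. [cite: Bouaziz1994IntegralesOrbitales, §5.1 p. 588] -/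
theorem bzClassMap_congr (S : Finset W) {c c' : W → Fin 3 → ℝ} {w : W} (h : c w = c' w) : bzClassMap S c w = bzClassMap S c' w := by
  simp only [bzClassMap, h]

/-- **`2π`-PERIODICITY**: the class map is unchanged by `angleShift w i k` at every ANGLE slot (`w ∉ S`, or `i ≠ 0`; the split coordinate `x = c_{w,0}`, `w ∈ S`, is not an angle).
[cite: Shelstad1979, §4 p. 22] [cite: Bouaziz1994IntegralesOrbitales, §5.1 p. 588] -/
theorem bzClassMap_add_angleShift (S : Finset W) (c : W → Fin 3 → ℝ) {w : W} {i : Fin 3} (h : w ∉ S ∨ i ≠ 0) (k : ℤ) :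
    bzClassMap S (c + angleShift w i k) = bzClassMap S c := by
  funext w'
  by_cases hw' : w' = w
  · subst hw'
    by_cases hS : w' ∈ S
    · have hi : i ≠ 0 := h.resolve_left (fun h' => h' hS)
      have h0 : (c + angleShift w' i k) w' 0 = c w' 0 := by
        rw [Pi.add_apply, Pi.add_apply, angleShift_apply_self_of_ne w' (Ne.symm hi), add_zero]
      rw [bzClassMap_of_mem hS, bzClassMap_of_mem hS, h0, circleExp_add_angleShift, circleExp_add_angleShift]
    · rw [bzClassMap_of_not_mem hS, bzClassMap_of_not_mem hS, circleExp_add_angleShift, circleExp_add_angleShift, circleExp_add_angleShift]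
  · exact bzClassMap_congr S (by rw [Pi.add_apply, angleShift_apply_of_ne hw', add_zero])

/-- **FLIP INVARIANCE** at a compact place `w ∉ S` (`θ₀ ↔ θ₂`: trace and determinant are symmetric). [cite: Shelstad1979, §4 p. 23] -/
theorem bzClassMap_flipAt (S : Finset W) {w : W} (hw : w ∉ S) (c : W → Fin 3 → ℝ) : bzClassMap S (flipAt w c) = bzClassMap S c := by
  funext w'
  by_cases hw' : w' = w
  · subst hw'
    rw [bzClassMap_of_not_mem hw, bzClassMap_of_not_mem hw, flipAt_apply_self]
    simp only [Matrix.cons_val_zero, Matrix.cons_val_one, Matrix.cons_val_two, Matrix.head_cons, Matrix.tail_cons]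
    rw [add_comm, mul_comm]
  · exact bzClassMap_congr S (flipAt_apply_of_ne hw' c)

/-- **SIGN-CHANGE INVARIANCE** at a split place `w ∈ S` (`x ↦ −x`: `eˣ + e⁻ˣ` is even). [cite: Shelstad1979, §4 p. 23] -/
theorem bzClassMap_negXAt (S : Finset W) {w : W} (hw : w ∈ S) (c : W → Fin 3 → ℝ) : bzClassMap S (negXAt w c) = bzClassMap S c := by
  funext w'
  by_cases hw' : w' = w
  · subst hw'
    rw [bzClassMap_of_mem hw, bzClassMap_of_mem hw, negXAt_apply_self]
    simp only [Matrix.cons_val_zero, Matrix.cons_val_one, Matrix.cons_val_two, Matrix.head_cons, Matrix.tail_cons, neg_neg]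
    rw [add_comm]
  · exact bzClassMap_congr S (negXAt_apply_of_ne hw' c)

/-- **STABLE-FLIP INVARIANCE**: flipping any set `T` of COMPACT places (`T ∩ S = ∅`) does not change the class data (★ `flipSet`; the stable sum of ★ `stOrbFamH` runs over these).
[cite: Shelstad1979, §4 p. 23] [cite: Rogawski1990, §3.7 Prop. 3.7.1 pp. 29–30] -/
theorem bzClassMap_flipSet (S : Finset W) {T : Finset W} (hT : ∀ w ∈ T, w ∉ S) (c : W → Fin 3 → ℝ) : bzClassMap S (flipSet T c) = bzClassMap S c := by
  funext w
  by_cases hw : w ∈ T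
  · rw [bzClassMap_of_not_mem (hT w hw), bzClassMap_of_not_mem (hT w hw), flipSet_apply_of_mem hw]
    simp only [Matrix.cons_val_zero, Matrix.cons_val_one, Matrix.cons_val_two, Matrix.head_cons, Matrix.tail_cons]
    rw [add_comm, mul_comm]
  · exact bzClassMap_congr S (flipSet_apply_of_not_mem hw c)

/-- **THE TWO-CHART SEAM**: at a wall point `s` of the compact place `w ∉ S` (`s_{w,0} = s_{w,2}`) the compact chart `S` and the split chart `insert w S` at the Cayley point `cayPt w s`
(`x = 0`, `θ = (s₀+s₂)/2 = s₀`) carry the same class data: `e^{is₀} + e^{is₂} = (e⁰ + e⁰) e^{is₀}`, `e^{is₀} e^{is₂} = e^{2is₀}`. [cite: Shelstad1979, §4 p. 25]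
[cite: Bouaziz1994IntegralesOrbitales, §3.2 p. 580] -/
theorem bzClassMap_insert_cayPt (S : Finset W) {w : W} (hw : w ∉ S) {s : W → Fin 3 → ℝ} (hs : s w 0 = s w 2) :
    bzClassMap (insert w S) (cayPt w s) = bzClassMap S s := by
  funext w'
  by_cases hw' : w' = w
  · subst hw'
    rw [bzClassMap_of_mem (Finset.mem_insert_self w' S), bzClassMap_of_not_mem hw, cayPt_apply_self]
    simp only [Matrix.cons_val_zero, Matrix.cons_val_one, Matrix.cons_val_two, Matrix.head_cons, Matrix.tail_cons, Real.exp_zero, neg_zero, hs]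
    refine Prod.ext ?_ (Prod.ext ?_ rfl)
    · push_cast; ring
    · simp only; ring
  · have hmem : w' ∈ insert w S ↔ w' ∈ S := by simp [Finset.mem_insert, hw']
    by_cases hS : w' ∈ S
    · rw [bzClassMap_of_mem (hmem.2 hS), bzClassMap_of_mem hS, cayPt_apply_of_ne hw']
    · rw [bzClassMap_of_not_mem (fun h => hS (hmem.1 h)), bzClassMap_of_not_mem hS, cayPt_apply_of_ne hw']

/-- **The class map is continuous in the coordinates** (each entry is a polynomial in `e^{±c_{w,0}}` and the circle points). [cite: Bouaziz1994IntegralesOrbitales, §2.3 p. 578] -/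
theorem continuous_bzClassMap (S : Finset W) : Continuous (bzClassMap S : (W → Fin 3 → ℝ) → W → ℂ × ℂ × ℂ) := by
  refine continuous_pi fun w => ?_
  have hc : ∀ i : Fin 3, Continuous fun c : W → Fin 3 → ℝ => c w i := fun i => (continuous_apply i).comp (continuous_apply w)
  have he : ∀ i : Fin 3, Continuous fun c : W → Fin 3 → ℝ => ((Circle.exp (c w i) : Circle) : ℂ) :=
    fun i => continuous_subtype_val.comp (Circle.exp.continuous.comp (hc i))
  by_cases hw : w ∈ S
  · have h : (fun c : W → Fin 3 → ℝ => bzClassMap S c w) = fun c =>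
        ((((Real.exp (c w 0) + Real.exp (-(c w 0)) : ℝ) : ℂ)) * (Circle.exp (c w 2) : ℂ), (Circle.exp (c w 2) : ℂ) ^ 2, (Circle.exp (c w 1) : ℂ)) :=
      funext fun c => bzClassMap_of_mem hw c
    rw [h]
    exact ((continuous_ofReal.comp ((Real.continuous_exp.comp (hc 0)).add (Real.continuous_exp.comp (hc 0).neg))).mul (he 2)).prodMk
      (((he 2).pow 2).prodMk (he 1))
  · have h : (fun c : W → Fin 3 → ℝ => bzClassMap S c w) = fun c =>
        (((Circle.exp (c w 0) : ℂ)) + (Circle.exp (c w 2) : ℂ), ((Circle.exp (c w 0) : ℂ)) * (Circle.exp (c w 2) : ℂ), (Circle.exp (c w 1) : ℂ)) :=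
      funext fun c => bzClassMap_of_not_mem hw c
    rw [h]
    exact ((he 0).add (he 2)).prodMk (((he 0).mul (he 2)).prodMk (he 1))

end ClassMap

/-! ## §2 Localised families -/

section Localized

variable [Fintype W] [DecidableEq W]

/-- **`BzLocalized Ψ b ε` — the family `Ψ` is LOCALISED at the base class `b` to radius `ε`**: it vanishes at every chart point whose class data are `ε`-far from `b`
(support compact modulo conjugation inside the `ε`-neighbourhood of the stable class `b`; Bouaziz's «supp_G(φ) ⊆ V_j»). [cite: Bouaziz1994IntegralesOrbitales, §5.1 p. 588] -/
def BzLocalized (Ψ : Finset W → (W → Fin 3 → ℝ) → ℂ) (b : W → ℂ × ℂ × ℂ) (ε : ℝ) : Prop :=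
  ∀ (S : Finset W) (c : W → Fin 3 → ℝ), ε ≤ dist (bzClassMap S c) b → Ψ S c = 0

/-- Unfolding of `BzLocalized`. [cite: Bouaziz1994IntegralesOrbitales, §5.1 p. 588] -/
theorem bzLocalized_iff (Ψ : Finset W → (W → Fin 3 → ℝ) → ℂ) (b : W → ℂ × ℂ × ℂ) (ε : ℝ) :
    BzLocalized Ψ b ε ↔ ∀ (S : Finset W) (c : W → Fin 3 → ℝ), ε ≤ dist (bzClassMap S c) b → Ψ S c = 0 :=
  Iff.rfl

/-- The zero family is localised everywhere. [cite: Bouaziz1994IntegralesOrbitales, §5.1 p. 588] -/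
theorem bzLocalized_zero (b : W → ℂ × ℂ × ℂ) (ε : ℝ) : BzLocalized (fun (_ : Finset W) (_ : W → Fin 3 → ℝ) => (0 : ℂ)) b ε :=
  fun _ _ _ => rfl

/-- Enlarging the radius bound keeps a family localised (`BzLocalized` is antitone in what it excludes). [cite: Bouaziz1994IntegralesOrbitales, §5.1 p. 588] -/
theorem BzLocalized.mono {Ψ : Finset W → (W → Fin 3 → ℝ) → ℂ} {b : W → ℂ × ℂ × ℂ} {ε ε' : ℝ} (h : BzLocalized Ψ b ε) (hε : ε ≤ ε') : BzLocalized Ψ b ε' :=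
  fun S c hc => h S c (hε.trans hc)

/-- Localised families are closed under addition. [cite: Bouaziz1994IntegralesOrbitales, §5.1 p. 588] -/
theorem BzLocalized.add {Ψ Ψ' : Finset W → (W → Fin 3 → ℝ) → ℂ} {b : W → ℂ × ℂ × ℂ} {ε : ℝ} (h : BzLocalized Ψ b ε) (h' : BzLocalized Ψ' b ε) :
    BzLocalized (fun S c => Ψ S c + Ψ' S c) b ε :=
  fun S c hc => by show Ψ S c + Ψ' S c = 0; rw [h S c hc, h' S c hc, add_zero]

/-- Localised families are closed under scalars. [cite: Bouaziz1994IntegralesOrbitales, §5.1 p. 588] -/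
theorem BzLocalized.smul {Ψ : Finset W → (W → Fin 3 → ℝ) → ℂ} {b : W → ℂ × ℂ × ℂ} {ε : ℝ} (h : BzLocalized Ψ b ε) (z : ℂ) :
    BzLocalized (fun S c => z * Ψ S c) b ε :=
  fun S c hc => by show z * Ψ S c = 0; rw [h S c hc, mul_zero]

/-- Localised families are closed under negation. [cite: Bouaziz1994IntegralesOrbitales, §5.1 p. 588] -/
theorem BzLocalized.neg {Ψ : Finset W → (W → Fin 3 → ℝ) → ℂ} {b : W → ℂ × ℂ × ℂ} {ε : ℝ} (h : BzLocalized Ψ b ε) :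
    BzLocalized (fun S c => -Ψ S c) b ε :=
  fun S c hc => by show -Ψ S c = 0; rw [h S c hc, neg_zero]

/-- Localised families are closed under finite sums. [cite: Bouaziz1994IntegralesOrbitales, §5.1 p. 588] -/
theorem BzLocalized.finset_sum {ι : Type*} (s : Finset ι) {Ψ : ι → Finset W → (W → Fin 3 → ℝ) → ℂ} {b : W → ℂ × ℂ × ℂ} {ε : ℝ} (h : ∀ i ∈ s, BzLocalized (Ψ i) b ε) :
    BzLocalized (fun S c => ∑ i ∈ s, Ψ i S c) b ε :=
  fun S c hc => by show ∑ i ∈ s, Ψ i S c = 0; exact Finset.sum_eq_zero fun i hi => h i hi S c hc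

/-- A product with ANY family is localised where one factor is. [cite: Bouaziz1994IntegralesOrbitales, §5.1 p. 588] -/
theorem BzLocalized.mul_left {Ψ : Finset W → (W → Fin 3 → ℝ) → ℂ} {b : W → ℂ × ℂ × ℂ} {ε : ℝ} (h : BzLocalized Ψ b ε) (χ : Finset W → (W → Fin 3 → ℝ) → ℂ) :
    BzLocalized (fun S c => χ S c * Ψ S c) b ε :=
  fun S c hc => by show χ S c * Ψ S c = 0; rw [h S c hc, mul_zero]

/-- **A family cut off by a CLASS function supported in the `ε`-ball of `b` is localised at `(b, ε)`**: if `F Y = 0` whenever `ε ≤ dist Y b`, then `(F ∘ bzClassMap S) · Ψ S` is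
`BzLocalized … b ε` (the multipliers of the invariant partition of unity). [cite: Bouaziz1994IntegralesOrbitales, §2.3 Lemme 2.3.1; §5.1 p. 588] -/
theorem bzLocalized_classMul {F : (W → ℂ × ℂ × ℂ) → ℂ} {b : W → ℂ × ℂ × ℂ} {ε : ℝ} (hF : ∀ Y, ε ≤ dist Y b → F Y = 0) (Ψ : Finset W → (W → Fin 3 → ℝ) → ℂ) :
    BzLocalized (fun S c => F (bzClassMap S c) * Ψ S c) b ε :=
  fun S c hc => by show F (bzClassMap S c) * Ψ S c = 0; rw [hF _ hc, zero_mul]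

/-- **Localisation transports along class-preserving moves**: periodic shifts, flips at compact places, sign changes at split places, and the Cayley move at a wall point do not
change `dist (bzClassMap S c) b`. [cite: Bouaziz1994IntegralesOrbitales, §5.1 p. 588] -/
theorem dist_bzClassMap_insert_cayPt (S : Finset W) {w : W} (hw : w ∉ S) {s : W → Fin 3 → ℝ} (hs : s w 0 = s w 2) (b : W → ℂ × ℂ × ℂ) :
    dist (bzClassMap (insert w S) (cayPt w s)) b = dist (bzClassMap S s) b := by
  rw [bzClassMap_insert_cayPt S hw hs]

end Localized

end Literature.NumberTheory.Rogawski1990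

end
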